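import Literature.MathematicalPhysics.QuantumManyBody.FreeDirichletGap
import Literature.MathematicalPhysics.QuantumManyBody.BoseGasThermodynamicLimitRuelle
import Mathlib.MeasureTheory.Integral.Prod
import Mathlib.MeasureTheory.Constructions.Pi
import HarnessLib

/-!
# One-coordinate slices and marginals of an `N`-body wave function

Topic `Literature/MathematicalPhysics/QuantumManyBody`, grouping namespace `BoseGas` (definition file;
wanted by the crux `RigidMomentumBound` of route `BECTangentRigidity`,
`Summits/AtomisticToContinuum/BoseEinsteinCondensation`, whose wall-flux bound is an argument about the
marginal density of ONE particle coordinate of a near-ground state near a Dirichlet wall).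

For a wave function `ψ : (ℝ³)^N → ℂ` and a particle coordinate `p = (i,k) ∈ Fin N × Fin 3` we single
out the real variable `t = x_{i,k}` and integrate over the remaining `3N - 1` coordinates
`y ∈ ℝ^{SliceIdx N p}`:

* `sliceMap p (t, y) : Config N` — the configuration with `x_p = t` and the other coordinates `y`
  (`configFlatten` followed by the split of the coordinate `p`); it is a measure-preserving
  bijection `ℝ × ℝ^{3N-1} → (ℝ³)^N` (`measurePreserving_sliceMap`), affine in `t`
  (`sliceMap_eq_add_smul`: `sliceMap p (t,y) = sliceMap p (0,y) + t e_p`);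
* Fubini along the coordinate: `lintegral_eq_lintegral_slice`, `integral_eq_integral_slice`, and the
  weighted forms `lintegral_weight_mul_eq_slice`, `integral_weight_mul_eq_slice` (a weight `g(x_p)`
  factors out of the slice integral);
* the **marginal mass** `marginalMass ψ p t = ∫_{x_p=t}|ψ|²` (and its real version
  `marginalMassReal`), the **normal slice kinetic energy** `normalSliceEnergy ψ p t = ∫_{x_p=t}|∂_pψ|²`
  (`normalSliceEnergyReal`), the **full slice energy** `sliceEnergy v ψ p t = ∫_{x_p=t}(|∇ψ|² + ∑v|ψ|²)`
  (`sliceEnergyReal`), the **slice current** `sliceCurrent ψ p t = Re∫_{x_p=t} ψ̄ ∂_pψ` (`= m'(t)/2`), and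
  the coordinate functional `coordL p : (ℝ³)^N →L[ℝ] ℝ`, `X ↦ x_p`;
* `lintegral_marginalMass`: `∫ m = ∫|ψ|²`.

The calculus of these objects (`m' = 2j`, Cauchy–Schwarz `j² ≤ m·e_t`, multipliers `g(c - x_p)`) is in
the sequel `OneCoordinateMarginalCalculus.lean`. Everything is standard measure theory (Fubini for the
product decomposition of Lebesgue measure) and is tagged folklore.
-/

noncomputable section

namespace Literature.MathematicalPhysics.QuantumManyBody.BoseGas

open _root_.MeasureTheory Filter Set Function
open scoped ENNReal NNReal Topology

variable {N : ℕ}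

/-- The index type of the coordinates OTHER than `p`. [folklore] -/
abbrev SliceIdx (N : ℕ) (p : Fin N × Fin 3) : Type := {q : Fin N × Fin 3 // ¬ q = p}

/-- The flattening measurable equivalence `(ℝ³)^N ≃ᵐ ℝ^{N×3}`. [folklore] -/
def configFlatten (N : ℕ) : Config N ≃ᵐ (Fin N × Fin 3 → ℝ) :=
  (MeasurableEquiv.piCongrRight fun _ : Fin N =>
      (MeasurableEquiv.toLp 2 (Fin 3 → ℝ)).symm).trans (MeasurableEquiv.curry (Fin N) (Fin 3) ℝ).symm

/-- The flattening map in coordinates. [folklore] -/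
theorem configFlatten_apply' (X : Config N) (q : Fin N × Fin 3) :
    configFlatten N X q = X q.1 q.2 := rfl

/-- Flattening preserves Lebesgue measure (restated for the named equivalence). [folklore] -/
theorem volume_preserving_configFlatten' (N : ℕ) :
    MeasurePreserving (configFlatten N) volume volume :=
  volume_preserving_configFlatten N

/-- Reassembling a flat coordinate vector from the distinguished coordinate `t` and the others. [folklore] -/
def sliceGlue (p : Fin N × Fin 3) (t : ℝ) (y : SliceIdx N p → ℝ) : Fin N × Fin 3 → ℝ :=
  fun q => if h : q = p then t else y ⟨q, h⟩

/-- The glued vector has `t` at the distinguished coordinate. [folklore] -/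
@[simp] theorem sliceGlue_same (p : Fin N × Fin 3) (t : ℝ) (y : SliceIdx N p → ℝ) :
    sliceGlue p t y p = t := by simp [sliceGlue]

/-- The glued vector has `y` at the other coordinates. [folklore] -/
theorem sliceGlue_of_ne (p : Fin N × Fin 3) (t : ℝ) (y : SliceIdx N p → ℝ) (q : SliceIdx N p) :
    sliceGlue p t y q = y q := by
  rcases q with ⟨q, hq⟩
  simp [sliceGlue, hq]

/-- The slice parametrisation `(t, y) ↦ X` with `X_{p} = t` and the other coordinates `y`. [folklore] -/
def sliceMap (p : Fin N × Fin 3) (z : ℝ × (SliceIdx N p → ℝ)) : Config N :=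
  (configFlatten N).symm (sliceGlue p z.1 z.2)

/-- On the slice, the distinguished coordinate equals `t`. [folklore] -/
theorem sliceMap_apply_same (p : Fin N × Fin 3) (z : ℝ × (SliceIdx N p → ℝ)) :
    sliceMap p z p.1 p.2 = z.1 := by
  have := configFlatten_apply' ((configFlatten N).symm (sliceGlue p z.1 z.2)) p
  rw [MeasurableEquiv.apply_symm_apply] at this
  rw [sliceMap, ← this, sliceGlue_same]

/-- `sliceGlue` as the inverse of `piEquivPiSubtypeProd` composed with `funUnique`. [folklore] -/
theorem sliceGlue_eq (p : Fin N × Fin 3) (t : ℝ) (y : SliceIdx N p → ℝ) :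
    sliceGlue p t y =
      (MeasurableEquiv.piEquivPiSubtypeProd (fun _ : Fin N × Fin 3 => ℝ) (fun q => q = p)).symm
        (fun _ => t, y) := by
  funext q
  by_cases h : q = p
  · subst h
    simp [sliceGlue, MeasurableEquiv.piEquivPiSubtypeProd, Equiv.piEquivPiSubtypeProd]
  · simp [sliceGlue, h, MeasurableEquiv.piEquivPiSubtypeProd, Equiv.piEquivPiSubtypeProd]

/-- The subtype `{q // q = p}` has exactly one element. [folklore] -/
instance (p : Fin N × Fin 3) : Unique {q : Fin N × Fin 3 // q = p} where
  default := ⟨p, rfl⟩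
  uniq := fun ⟨q, hq⟩ => by subst hq; rfl

/-- The slice parametrisation as a composition of measurable equivalences. [folklore] -/
def sliceEquiv (p : Fin N × Fin 3) : ℝ × (SliceIdx N p → ℝ) ≃ᵐ Config N :=
  ((MeasurableEquiv.funUnique {q : Fin N × Fin 3 // q = p} ℝ).symm.prodCongr
      (MeasurableEquiv.refl _)).trans
    ((MeasurableEquiv.piEquivPiSubtypeProd (fun _ : Fin N × Fin 3 => ℝ) (fun q => q = p)).symm.trans
      (configFlatten N).symm)

/-- The measurable equivalence is the slice parametrisation. [folklore] -/
theorem sliceEquiv_apply (p : Fin N × Fin 3) (z : ℝ × (SliceIdx N p → ℝ)) :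
    sliceEquiv p z = sliceMap p z := by
  rcases z with ⟨t, y⟩
  simp only [sliceEquiv, MeasurableEquiv.trans_apply, sliceMap, sliceGlue_eq]
  rfl

/-- `Measure.pi` does not depend on the `Fintype` instance. [folklore] -/
theorem measurePi_congr_fintype {ι : Type*} (i₁ i₂ : Fintype ι) {α : ι → Type*}
    [∀ i, MeasurableSpace (α i)] (μ : ∀ i, Measure (α i)) :
    @Measure.pi ι α i₁ _ μ = @Measure.pi ι α i₂ _ μ := by
  rw [Subsingleton.elim i₁ i₂]

/-- The slice equivalence preserves Lebesgue measure. [folklore] -/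
theorem measurePreserving_sliceEquiv (p : Fin N × Fin 3) :
    MeasurePreserving (sliceEquiv p) volume volume := by
  -- the three pieces, with the measures they naturally carry
  have h2 := (measurePreserving_piEquivPiSubtypeProd (fun _ : Fin N × Fin 3 => (volume : Measure ℝ))
    (fun q => q = p)).symm _
  have h1 := MeasurePreserving.prod
    ((measurePreserving_funUnique (volume : Measure ℝ) {q : Fin N × Fin 3 // q = p}).symm _)
    (MeasurePreserving.id (Measure.pi fun _ : SliceIdx N p => (volume : Measure ℝ)))
  have h12 : MeasurePreserving
      ((MeasurableEquiv.piEquivPiSubtypeProd (fun _ : Fin N × Fin 3 => ℝ) (fun q => q = p)).symm ∘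
        Prod.map (MeasurableEquiv.funUnique {q : Fin N × Fin 3 // q = p} ℝ).symm id)
      ((volume : Measure ℝ).prod (Measure.pi fun _ : SliceIdx N p => (volume : Measure ℝ)))
      (Measure.pi fun _ : Fin N × Fin 3 => (volume : Measure ℝ)) := by
    refine h2.comp ?_
    convert h1 using 2
    exact measurePi_congr_fintype _ _ _
  have h3 := (volume_preserving_configFlatten' N).symm _
  rw [Measure.volume_eq_prod]
  exact h3.comp h12

/-- **The slice parametrisation preserves Lebesgue measure**: `(t, y) ↦ X` with `X_p = t`. [folklore] -/
theorem measurePreserving_sliceMap (p : Fin N × Fin 3) :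
    MeasurePreserving (sliceMap p) (volume : Measure (ℝ × (SliceIdx N p → ℝ))) volume := by
  have h := measurePreserving_sliceEquiv p
  have hfun : (sliceEquiv p : ℝ × (SliceIdx N p → ℝ) → Config N) = sliceMap p :=
    funext (sliceEquiv_apply p)
  rwa [hfun] at h

/-- **Fubini along one coordinate**: a whole-space lower integral is the iterated integral over the
distinguished coordinate `t` and the slice. [folklore] -/
theorem lintegral_eq_lintegral_slice (p : Fin N × Fin 3) {F : Config N → ℝ≥0∞} (hF : Measurable F) :
    ∫⁻ X, F X = ∫⁻ t : ℝ, ∫⁻ y : SliceIdx N p → ℝ, F (sliceMap p (t, y)) := by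
  rw [← (measurePreserving_sliceMap p).lintegral_comp hF, Measure.volume_eq_prod]
  exact lintegral_prod _ (hF.comp (measurePreserving_sliceMap p).measurable).aemeasurable

/-- Bochner version of `lintegral_eq_lintegral_slice` for integrable functions. [folklore] -/
theorem integral_eq_integral_slice (p : Fin N × Fin 3) {F : Config N → ℝ} (hF : Integrable F) :
    ∫ X, F X = ∫ t : ℝ, ∫ y : SliceIdx N p → ℝ, F (sliceMap p (t, y)) := by
  have hmp := measurePreserving_sliceMap p
  have hemb : MeasurableEmbedding (sliceMap p) := by
    have : (sliceMap p) = (sliceEquiv p : ℝ × (SliceIdx N p → ℝ) → Config N) :=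
      (funext (sliceEquiv_apply p)).symm
    rw [this]; exact (sliceEquiv p).measurableEmbedding
  rw [← hmp.integral_comp hemb, Measure.volume_eq_prod]
  exact integral_prod _ ((hmp.integrable_comp_emb hemb).2 hF)

/-- Coordinates of a point of the slice parametrisation. [folklore] -/
theorem sliceMap_apply (p : Fin N × Fin 3) (t : ℝ) (y : SliceIdx N p → ℝ) (i : Fin N) (k : Fin 3) :
    sliceMap p (t, y) i k = if h : (i, k) = p then t else y ⟨(i, k), h⟩ := by
  have := configFlatten_apply' ((configFlatten N).symm (sliceGlue p t y)) (i, k)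
  rw [MeasurableEquiv.apply_symm_apply] at this
  rw [sliceMap, ← this]
  rfl

/-- The slice parametrisation is affine in the distinguished coordinate:
`sliceMap p (t, y) = sliceMap p (0, y) + t • e_p`. [folklore] -/
theorem sliceMap_eq_add_smul (p : Fin N × Fin 3) (t : ℝ) (y : SliceIdx N p → ℝ) :
    sliceMap p (t, y) = sliceMap p (0, y) + t • unitVec p.1 p.2 := by
  funext i; ext k
  simp only [Pi.add_apply, Pi.smul_apply, PiLp.add_apply, PiLp.smul_apply, smul_eq_mul,
    sliceMap_apply, unitVec]
  by_cases h : (i, k) = p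
  · have h1 : i = p.1 := congrArg Prod.fst h
    have h2 : k = p.2 := congrArg Prod.snd h
    subst h1; subst h2
    simp
  · simp only [h, ↓reduceDIte]
    have : (Pi.single p.1 (EuclideanSpace.single p.2 (1 : ℝ)) : Config N) i k = 0 := by
      by_cases hi : i = p.1
      · subst hi
        have hk : k ≠ p.2 := fun hk => h (by rw [hk])
        simp [hk]
      · simp [hi]
    rw [this]; ring

/-- **Weighted Fubini along one coordinate**: a weight depending only on the coordinate `x_p`
factors out of the slice integral. [folklore] -/
theorem lintegral_weight_mul_eq_slice (p : Fin N × Fin 3) {g : ℝ → ℝ≥0∞} (hg : Measurable g)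
    {F : Config N → ℝ≥0∞} (hF : Measurable F) :
    ∫⁻ X, g (X p.1 p.2) * F X = ∫⁻ t : ℝ, g t * ∫⁻ y : SliceIdx N p → ℝ, F (sliceMap p (t, y)) := by
  have hcoord : Measurable fun X : Config N => X p.1 p.2 := by
    have : Continuous fun X : Config N => X p.1 p.2 := by fun_prop
    exact this.measurable
  have hgm : Measurable fun X : Config N => g (X p.1 p.2) := hg.comp hcoord
  rw [lintegral_eq_lintegral_slice p (F := fun X => g (X p.1 p.2) * F X) (hgm.mul hF)]
  refine lintegral_congr fun t => ?_
  have : ∀ y : SliceIdx N p → ℝ, g (sliceMap p (t, y) p.1 p.2) = g t := fun y => by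
    rw [sliceMap_apply_same]
  simp_rw [this]
  have hm : Measurable fun y : SliceIdx N p → ℝ => F (sliceMap p (t, y)) :=
    hF.comp ((measurePreserving_sliceMap p).measurable.comp (measurable_const.prodMk measurable_id))
  exact lintegral_const_mul _ hm

/-! ### Marginal mass, slice current and slice energies -/

/-- The **one-coordinate marginal mass** `m(t) = ∫_{x_p = t} |ψ|²` (as an extended nonnegative real). [folklore] -/
def marginalMass (ψ : Config N → ℂ) (p : Fin N × Fin 3) (t : ℝ) : ℝ≥0∞ :=
  ∫⁻ y : SliceIdx N p → ℝ, (‖ψ (sliceMap p (t, y))‖₊ : ℝ≥0∞) ^ 2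

/-- The **normal slice kinetic energy** `e_t(t) = ∫_{x_p = t} |∂_p ψ|²`. [folklore] -/
def normalSliceEnergy (ψ : Config N → ℂ) (p : Fin N × Fin 3) (t : ℝ) : ℝ≥0∞ :=
  ∫⁻ y : SliceIdx N p → ℝ, (‖fderiv ℝ ψ (sliceMap p (t, y)) (unitVec p.1 p.2)‖₊ : ℝ≥0∞) ^ 2

/-- The **full slice energy** `e(t) = ∫_{x_p = t} (|∇ψ|² + ∑v|ψ|²)`. [folklore] -/
def sliceEnergy (v : ℝ → ℝ≥0∞) (ψ : Config N → ℂ) (p : Fin N × Fin 3) (t : ℝ) : ℝ≥0∞ :=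
  ∫⁻ y : SliceIdx N p → ℝ, (kineticDensity ψ (sliceMap p (t, y)) +
    interaction v (sliceMap p (t, y)) * (‖ψ (sliceMap p (t, y))‖₊ : ℝ≥0∞) ^ 2)

/-- The **slice current** `j(t) = Re ∫_{x_p = t} conj(ψ) ∂_p ψ` (`= m'(t)/2`). [folklore] -/
def sliceCurrent (ψ : Config N → ℂ) (p : Fin N × Fin 3) (t : ℝ) : ℝ :=
  ∫ y : SliceIdx N p → ℝ, RCLike.re (starRingEnd ℂ (ψ (sliceMap p (t, y))) *
    fderiv ℝ ψ (sliceMap p (t, y)) (unitVec p.1 p.2))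

/-- Total mass is the integral of the marginal mass. [folklore] -/
theorem lintegral_marginalMass (ψ : Config N → ℂ) (hψ : Measurable ψ) (p : Fin N × Fin 3) :
    ∫⁻ t, marginalMass ψ p t = ∫⁻ X, (‖ψ X‖₊ : ℝ≥0∞) ^ 2 := by
  rw [lintegral_eq_lintegral_slice p]
  · rfl
  · exact (hψ.nnnorm.coe_nnreal_ennreal).pow_const 2

/-! ### Real-valued slice integrals and the weighted Fubini identities -/

/-- Bochner weighted Fubini: a real weight of the coordinate `x_p` factors out of the slice integral. [folklore] -/
theorem integral_weight_mul_eq_slice (p : Fin N × Fin 3) (g : ℝ → ℝ) {F : Config N → ℝ}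
    (hgF : Integrable fun X => g (X p.1 p.2) * F X) :
    ∫ X, g (X p.1 p.2) * F X = ∫ t : ℝ, g t * ∫ y : SliceIdx N p → ℝ, F (sliceMap p (t, y)) := by
  rw [integral_eq_integral_slice p hgF]
  refine integral_congr_ae (Filter.Eventually.of_forall fun t => ?_)
  have : ∀ y : SliceIdx N p → ℝ, g (sliceMap p (t, y) p.1 p.2) = g t := fun y => by
    rw [sliceMap_apply_same]
  simp only [this]
  exact integral_const_mul _ _


/-! ### Real-valued versions and the coordinate functional -/

/-- Real-valued marginal mass `m(t) = ∫_{x_p=t} |ψ|²`. [folklore] -/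
def marginalMassReal (ψ : Config N → ℂ) (p : Fin N × Fin 3) (t : ℝ) : ℝ :=
  ∫ y : SliceIdx N p → ℝ, ‖ψ (sliceMap p (t, y))‖ ^ 2

/-- Real-valued normal slice kinetic energy `∫_{x_p=t} |∂_pψ|²`. [folklore] -/
def normalSliceEnergyReal (ψ : Config N → ℂ) (p : Fin N × Fin 3) (t : ℝ) : ℝ :=
  ∫ y : SliceIdx N p → ℝ, ‖fderiv ℝ ψ (sliceMap p (t, y)) (unitVec p.1 p.2)‖ ^ 2

/-- Real-valued full slice energy `e(t) = ∫_{x_p=t} (|∇ψ|² + ∑v|ψ|²)` (finite for finite-energy states). [folklore] -/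
def sliceEnergyReal (v : ℝ → ℝ≥0∞) (ψ : Config N → ℂ) (p : Fin N × Fin 3) (t : ℝ) : ℝ :=
  ∫ y : SliceIdx N p → ℝ, (kineticDensity ψ (sliceMap p (t, y)) +
    interaction v (sliceMap p (t, y)) * (‖ψ (sliceMap p (t, y))‖₊ : ℝ≥0∞) ^ 2).toReal

/-- The coordinate functional `X ↦ x_p` as a continuous linear map. [folklore] -/
def coordL (p : Fin N × Fin 3) : Config N →L[ℝ] ℝ :=
  (EuclideanSpace.proj (𝕜 := ℝ) (ι := Fin 3) p.2).comp
    (ContinuousLinearMap.proj (R := ℝ) (φ := fun _ : Fin N => EuclideanSpace ℝ (Fin 3)) p.1)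

/-- `coordL p X = x_p`. [folklore] -/
@[simp] theorem coordL_apply (p : Fin N × Fin 3) (X : Config N) : coordL p X = X p.1 p.2 := rfl

/-- `X ↦ x_p` is measurable. [folklore] -/
theorem measurable_coord' (p : Fin N × Fin 3) : Measurable fun X : Config N => X p.1 p.2 :=
  (coordL p).continuous.measurable

end Literature.MathematicalPhysics.QuantumManyBody.BoseGas

end
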